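import Summits.CriticalPhenomena.CardyFormulaZ2.Theorems.CardyBoundaryCoulombGasBoundaryDefectGaussianRStubTransportPathsPart9
import Literature.Probability.LatticeModels.CollarLegModelStrands

/-!
# Stub `stub_realisability` of line `rainbow-monomials-in-excursion-kernels` — Part 20:
# strand ends of the collar walk (I): local lattice geometry of a flat boundary rail
# (crux `BoundaryDefectGaussianR`, stmt-CriticalPhenomena-14132; insertion dictionary D2, layer 3b)

First of four files on the STRAND ENDS `LegInsertionData.strandEnds` of the jump collar of an
admissible leg insertion with FLAT insertion points (`Literature.Probability.LatticeModels.CollarLegModelRainbow`):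
the registered sub-goals `s14_strandEnds_tags` (Part 22: the tags are exactly `-L … -1`, each
carried by exactly two ends) and `s14_strandEnds_pairs` (Part 23: every end is a tracked corner
whose two cells carry the heights `m, m + 1`). This file is the frame geometry they rest on.

Frame of an out-direction `K : Fin 4` at a lattice point `c` (`dir K` points out of `V`, the
boundary walk `dsucc` moves along `dir (K+1)`): points are written `c + s • dir (K+1) + t • dir K`
(`se_frame_inj`, `se_frame_normSq`, `se_dir_frame`), and a CHART is the membership rule `t ≤ 0`.

* `se_chart_of_flat` — the flatness clause of the crux stubs at an insertion point `x` (Euclidean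
  radius `L + 3`, half-plane `0 ≤ ⟨v - x, d⟩`, `x + dir K ∉ V`) gives `d = -dir K` and the frame
  chart for `-3 ≤ s ≤ L + 1`, `|t| ≤ 2`;
* at a rail point `c` with the radius-`2` chart (`tp_rail_local`): the out-direction is unique
  (`se_rail_dir_unique`, `se_rail_dart_unique`); **the ghost `c + dir K` is the tip of no other
  exterior dart** (`se_rail_tip_unique`); **the gap face after `(c, K)` is the gap face of no other
  exterior dart** (`se_rail_gapFace_unique`); **an exterior dart whose gap face has the ghost as a
  corner is `(c, K)` or the previous rail dart `(c - dir (K+1), K)`** (`se_rail_ghostCorner`);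
* the gap faces of the rail darts in the corner coding of the medial strands
  (`se_gapFace_eq_cFace`: the face after `(c, K)` is the face of the corners `(c, K)` and
  `(c + dir K, K + 1)`, the face before is that of `(c, K + 3)` and `(c + dir K, K + 2)`), their
  corners (`se_faceCorners_gapFace`) and the faces at `c` (`se_gapFace_mem_vertexFaces`);
* one dart of the walk refined (`se_step_none_of_pending`, `se_step_some`).

Registered one-line form: `s14_strandEnds_rail`. All [folklore] lattice bookkeeping.
-/

namespace Summit.CriticalPhenomena.CardyFormulaZ2.Cruxes.BoundaryDefectGaussianR.RainbowMonomialsInExcursionKernels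

open Literature.Probability.LatticeModels Literature.Probability.LatticeModels.CollarLegModel

/-! ### Frame algebra around a rail point `c` with out-direction `K` -/

/-- Frame coordinates are unique: `c + a • dir (K+1) + b • dir K` determines `(a, b)`. [folklore] -/
theorem se_frame_inj (K : Fin 4) (c : ℤ × ℤ) (a b a' b' : ℤ) :
    c + a • dir (K + 1) + b • dir K = c + a' • dir (K + 1) + b' • dir K ↔ a = a' ∧ b = b' := by
  obtain ⟨p, q⟩ := c
  fin_cases K <;> simp [tp_dir_val, Prod.ext_iff] <;> omega

/-- The squared Euclidean distance of a frame point from the frame origin is `s² + t²`. [folklore] -/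
theorem se_frame_normSq (K : Fin 4) (c : ℤ × ℤ) (s t : ℤ) :
    ((c + s • dir (K + 1) + t • dir K).1 - c.1) ^ 2 + ((c + s • dir (K + 1) + t • dir K).2 - c.2) ^ 2 =
      s ^ 2 + t ^ 2 := by
  obtain ⟨p, q⟩ := c
  fin_cases K <;> simp [tp_dir_val] <;> ring

/-- Every direction is `K`, `K + 1`, `K + 2` or `K + 3`. [folklore] -/
theorem se_fin4_cases (K k : Fin 4) : k = K ∨ k = K + 1 ∨ k = K + 2 ∨ k = K + 3 := by
  revert K k; decide

/-- The unit steps in frame coordinates: `dir K`, `dir (K+1)`, `dir (K+2) = -dir K`,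
`dir (K+3) = -dir (K+1)`. [folklore] -/
theorem se_dir_frame (K : Fin 4) (c : ℤ × ℤ) :
    c + dir K = c + (0 : ℤ) • dir (K + 1) + (1 : ℤ) • dir K ∧
    c + dir (K + 1) = c + (1 : ℤ) • dir (K + 1) + (0 : ℤ) • dir K ∧
    c + dir (K + 2) = c + (0 : ℤ) • dir (K + 1) + (-1 : ℤ) • dir K ∧
    c + dir (K + 3) = c + (-1 : ℤ) • dir (K + 1) + (0 : ℤ) • dir K := by
  refine ⟨by module, by module, ?_, ?_⟩
  · rw [tp_dir_add_two]; module
  · rw [tp_dir_add_three]; module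

/-! ### From the flatness clause to a frame chart -/

/-- **Flat insertion point ⇒ frame chart.** If within Euclidean radius `L + 3` of `x` membership
in `V` is the half-plane rule `0 ≤ ⟨v - x, d⟩` for a unit vector `d`, and `x + dir K ∉ V`, then
`d = -dir K` and, in the frame of the out-direction `K`, membership of `x + s • dir (K+1) + t • dir K`
for `-3 ≤ s ≤ L + 1`, `|t| ≤ 2` is `t ≤ 0`. [folklore] -/
theorem se_chart_of_flat (V : Finset (ℤ × ℤ)) (x : ℤ × ℤ) (K : Fin 4) (L : ℕ) (hL : 1 ≤ L)
    (hxK : x + dir K ∉ V) {d : ℤ × ℤ} (hd : d = (1, 0) ∨ d = (-1, 0) ∨ d = (0, 1) ∨ d = (0, -1))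
    (hflat : ∀ v : ℤ × ℤ, (v.1 - x.1) ^ 2 + (v.2 - x.2) ^ 2 ≤ ((L : ℤ) + 3) ^ 2 →
      (v ∈ V ↔ 0 ≤ (v.1 - x.1) * d.1 + (v.2 - x.2) * d.2)) :
    ∀ s t : ℤ, -3 ≤ s → s ≤ (L : ℤ) + 1 → -2 ≤ t → t ≤ 2 →
      (x + s • dir (K + 1) + t • dir K ∈ V ↔ t ≤ 0) := by
  have hu : dir K = (1, 0) ∨ dir K = (-1, 0) ∨ dir K = (0, 1) ∨ dir K = (0, -1) := by
    fin_cases K <;> simp [tp_dir_val]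
  have hdist1 : ((x + dir K).1 - x.1) ^ 2 + ((x + dir K).2 - x.2) ^ 2 ≤ ((L : ℤ) + 3) ^ 2 := by
    have h1 : ((x + dir K).1 - x.1) ^ 2 + ((x + dir K).2 - x.2) ^ 2 = 1 := by
      obtain ⟨p, q⟩ := x
      fin_cases K <;> simp [tp_dir_val]
    rw [h1]; nlinarith
  have hneg : ¬ (0 ≤ (dir K).1 * d.1 + (dir K).2 * d.2) := by
    intro h0
    refine hxK ((hflat (x + dir K) hdist1).2 ?_)
    simpa using h0
  have hdK : d = -dir K := by
    rcases hu with h | h | h | h <;> rcases hd with rfl | rfl | rfl | rfl <;> rw [h] at hneg ⊢ <;>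
      simp at hneg ⊢
  intro s t hs1 hs2 ht1 ht2
  have hdist : ((x + s • dir (K + 1) + t • dir K).1 - x.1) ^ 2 +
      ((x + s • dir (K + 1) + t • dir K).2 - x.2) ^ 2 ≤ ((L : ℤ) + 3) ^ 2 := by
    rw [se_frame_normSq]
    by_cases hs3 : s ≤ 3
    · nlinarith
    · nlinarith
  rw [hflat _ hdist, hdK]
  have hc := (tp_coord K x s t).1
  simp only [Prod.fst_neg, Prod.snd_neg, mul_neg, ← neg_add, neg_nonneg]
  rw [hc]

/-! ### Local facts at a rail point `c` (chart of frame radius `2`) -/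

section Rail

variable {V : Finset (ℤ × ℤ)} {K : Fin 4} {c : ℤ × ℤ}
  (hc : ∀ s t : ℤ, -2 ≤ s → s ≤ 2 → -2 ≤ t → t ≤ 2 → (c + s • dir (K + 1) + t • dir K ∈ V ↔ t ≤ 0))
include hc

/-- A rail point lies in `V`, its `dir K`-neighbour does not, it has exactly one outside
neighbour, `outDart V c = (c, K)`, and the walk steps `(c - dir (K+1), K) ↦ (c, K) ↦ (c + dir (K+1), K)`
(`tp_rail_local`). [folklore] -/
theorem se_rail_local : c ∈ V ∧ c + dir K ∉ V ∧ ((neighbours c).filter (fun y => y ∉ V)).card = 1 ∧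
    outDart V c = some (c, K) ∧ dsucc V (c, K) = (c + dir (K + 1), K) ∧
    dsucc V (c - dir (K + 1), K) = (c, K) :=
  tp_rail_local V K c hc

/-- The out-direction at a rail point is unique. [folklore] -/
theorem se_rail_dir_unique {k : Fin 4} (hk : c + dir k ∉ V) : k = K := by
  obtain ⟨-, hK, hcard, hout, -⟩ := se_rail_local hc
  obtain ⟨k₀, hk₀, -, huniq⟩ := s3_outDart_of_card V c hcard
  rw [hout] at hk₀
  have : K = k₀ := by simpa using hk₀
  rw [huniq k hk, this]

/-- An exterior dart at a rail point is the rail dart. [folklore] -/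
theorem se_rail_dart_unique {d : Dart} (hd1 : d.1 = c) (hd2 : dartTip d ∉ V) : d = (c, K) := by
  obtain ⟨v, k⟩ := d
  simp only at hd1
  subst hd1
  simp only [dartTip] at hd2
  rw [se_rail_dir_unique hc hd2]

/-- **Ghost uniqueness.** The only exterior dart whose tip is the ghost `c + dir K` of the rail
point `c` is the rail dart `(c, K)`. [folklore] -/
theorem se_rail_tip_unique {d : Dart} (hd1 : d.1 ∈ V) (hd2 : dartTip d = c + dir K) : d = (c, K) := by
  obtain ⟨v, k⟩ := d
  simp only [dartTip] at hd2
  simp only at hd1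
  have hv : v = c + dir K - dir k := by rw [← hd2]; abel
  obtain ⟨e0, e1, e2, e3⟩ := se_dir_frame K c
  rcases se_fin4_cases K k with rfl | rfl | rfl | rfl
  · have : v = c := by rw [hv]; abel
    rw [this]
  · exfalso
    have h' : v = c + (-1 : ℤ) • dir (K + 1) + (1 : ℤ) • dir K := by rw [hv]; module
    have := (hc (-1) 1 (by norm_num) (by norm_num) (by norm_num) (by norm_num)).1 (h' ▸ hd1)
    omega
  · exfalso
    have h' : v = c + (0 : ℤ) • dir (K + 1) + (2 : ℤ) • dir K := by rw [hv, tp_dir_add_two]; module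
    have := (hc 0 2 (by norm_num) (by norm_num) (by norm_num) (by norm_num)).1 (h' ▸ hd1)
    omega
  · exfalso
    have h' : v = c + (1 : ℤ) • dir (K + 1) + (1 : ℤ) • dir K := by rw [hv, tp_dir_add_three]; module
    have := (hc 1 1 (by norm_num) (by norm_num) (by norm_num) (by norm_num)).1 (h' ▸ hd1)
    omega

end Rail

/-! ### Gap faces and their corners in frame coordinates -/

/-- The corners of the gap face of the dart `(c, K)`: `c`, `c + dir (K+1)`, `c + dir K`,
`c + dir K + dir (K+1)`. [folklore] -/
theorem se_faceCorners_gapFace (c : ℤ × ℤ) (K : Fin 4) :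
    SixVertex.faceCorners (gapFace (c, K)) = {c, c + dir (K + 1), c + dir K, c + dir K + dir (K + 1)} := by
  obtain ⟨p, q⟩ := c
  ext ⟨a, b⟩
  fin_cases K <;> simp [gapFace, SixVertex.faceCorners, tp_dir_val] <;> omega

/-- The vertex of a dart is a corner of its gap face. [folklore] -/
theorem se_self_mem_faceCorners_gapFace (d : Dart) : d.1 ∈ SixVertex.faceCorners (gapFace d) := by
  obtain ⟨c, K⟩ := d
  rw [se_faceCorners_gapFace]
  simp

/-- The ghost `c + dir K` is a corner of the gap face after the dart `(c, K)` and of the gap face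
after the previous rail dart `(c - dir (K+1), K)` (the face before `(c, K)`). [folklore] -/
theorem se_ghost_mem_faceCorners (c : ℤ × ℤ) (K : Fin 4) :
    c + dir K ∈ SixVertex.faceCorners (gapFace (c, K)) ∧
      c + dir K ∈ SixVertex.faceCorners (gapFace (c - dir (K + 1), K)) := by
  rw [se_faceCorners_gapFace, se_faceCorners_gapFace]
  refine ⟨by simp, ?_⟩
  have : c + dir K = c - dir (K + 1) + dir K + dir (K + 1) := by abel
  simp [← this]

/-- The gap face determines the direction of a dart at a given vertex. [folklore] -/
theorem se_gapFace_inj_dir (c : ℤ × ℤ) {K k : Fin 4} (h : gapFace (c, k) = gapFace (c, K)) : k = K := by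
  obtain ⟨p, q⟩ := c
  fin_cases K <;> fin_cases k <;> simp [gapFace, Prod.ext_iff] at h ⊢ <;> omega

/-- A dart at the next rail point with the same gap face as `(c, K)` points backwards. [folklore] -/
theorem se_gapFace_next (c : ℤ × ℤ) {K k : Fin 4} (h : gapFace (c + dir (K + 1), k) = gapFace (c, K)) :
    k = K + 3 := by
  obtain ⟨p, q⟩ := c
  fin_cases K <;> fin_cases k <;> simp [gapFace, tp_dir_val, Prod.ext_iff] at h ⊢ <;> omega

/-- The gap faces of the rail darts in the corner coding of the medial strands: the gap face after
`(c, K)` is the face of the corners `(c, K)` and `(c + dir K, K + 1)`; the gap face after the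
previous rail dart `(c - dir (K+1), K)` (the face before `(c, K)`) is the face of the corners
`(c, K + 3)` and `(c + dir K, K + 2)`. [folklore] -/
theorem se_gapFace_eq_cFace (c : ℤ × ℤ) (K : Fin 4) :
    gapFace (c, K) = ofSite (cFace (toSite c, K)) ∧
    gapFace (c, K) = ofSite (cFace (toSite (c + dir K), K + 1)) ∧
    gapFace (c - dir (K + 1), K) = ofSite (cFace (toSite c, K + 3)) ∧
    gapFace (c - dir (K + 1), K) = ofSite (cFace (toSite (c + dir K), K + 2)) := by
  obtain ⟨p, q⟩ := c
  rw [ofSite_cFace_toSite, ofSite_cFace_toSite, ofSite_cFace_toSite, ofSite_cFace_toSite]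
  fin_cases K <;> simp [gapFace, tp_dir_val, sub_eq_add_neg]

/-- Gap faces of rail darts around `c` are faces at `c`. [folklore] -/
theorem se_gapFace_mem_vertexFaces (c : ℤ × ℤ) (K : Fin 4) :
    gapFace (c, K) ∈ SixVertex.vertexFaces c ∧ gapFace (c - dir (K + 1), K) ∈ SixVertex.vertexFaces c ∧
      gapFace (c, K) ∈ SixVertex.vertexFaces (c + dir K) ∧
      gapFace (c - dir (K + 1), K) ∈ SixVertex.vertexFaces (c + dir K) := by
  obtain ⟨p, q⟩ := c
  fin_cases K <;> simp [gapFace, SixVertex.vertexFaces, tp_dir_val] <;> ring_nf <;> simp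

/-- The ghost is a lattice neighbour of the rail point. [folklore] -/
theorem se_ghost_mem_neighbours (c : ℤ × ℤ) (K : Fin 4) : c + dir K ∈ neighbours c := by
  obtain ⟨p, q⟩ := c
  fin_cases K <;> simp [neighbours, tp_dir_val, sub_eq_add_neg]

/-- Two corners of a unit face are within `ℓ∞`-distance `1`. [folklore] -/
theorem se_corners_close {f a b : ℤ × ℤ} (ha : a ∈ SixVertex.faceCorners f) (hb : b ∈ SixVertex.faceCorners f) :
    max |a.1 - b.1| |a.2 - b.2| ≤ 1 := by
  obtain ⟨p, q⟩ := f
  simp only [SixVertex.faceCorners, Finset.mem_insert, Finset.mem_singleton] at ha hb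
  rcases ha with rfl | rfl | rfl | rfl <;> rcases hb with rfl | rfl | rfl | rfl <;> simp

section Rail2

variable {V : Finset (ℤ × ℤ)} {K : Fin 4} {c : ℤ × ℤ}
  (hc : ∀ s t : ℤ, -2 ≤ s → s ≤ 2 → -2 ≤ t → t ≤ 2 → (c + s • dir (K + 1) + t • dir K ∈ V ↔ t ≤ 0))
include hc

/-- **Gap-face uniqueness.** The only exterior dart whose gap face is the gap face after the rail
dart `(c, K)` is `(c, K)` itself. [folklore] -/
theorem se_rail_gapFace_unique {d : Dart} (hd1 : d.1 ∈ V) (hd2 : dartTip d ∉ V)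
    (h : gapFace d = gapFace (c, K)) : d = (c, K) := by
  obtain ⟨v, k⟩ := d
  obtain ⟨e0, e1, e2, e3⟩ := se_dir_frame K c
  have hv : v ∈ SixVertex.faceCorners (gapFace (c, K)) := h ▸ se_self_mem_faceCorners_gapFace (v, k)
  rw [se_faceCorners_gapFace] at hv
  simp only [Finset.mem_insert, Finset.mem_singleton] at hv
  simp only at hd1
  rcases hv with rfl | rfl | rfl | rfl
  · rw [se_gapFace_inj_dir v h]
  · exfalso
    have hk := se_gapFace_next c h
    subst hk
    simp only [dartTip] at hd2
    rw [tp_dir_add_three, ← sub_eq_add_neg, add_sub_cancel_right] at hd2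
    exact hd2 (se_rail_local hc).1
  · exfalso
    have := (hc 0 1 (by norm_num) (by norm_num) (by norm_num) (by norm_num)).1 (e0 ▸ hd1)
    omega
  · exfalso
    have e : c + dir K + dir (K + 1) = c + (1 : ℤ) • dir (K + 1) + (1 : ℤ) • dir K := by module
    have := (hc 1 1 (by norm_num) (by norm_num) (by norm_num) (by norm_num)).1 (e ▸ hd1)
    omega

/-- **Pocket-corner uniqueness.** An exterior dart whose gap face has the ghost `c + dir K` as a
corner is the rail dart `(c, K)` or the previous rail dart `(c - dir (K+1), K)`. [folklore] -/
theorem se_rail_ghostCorner {d : Dart} (hd1 : d.1 ∈ V) (hd2 : dartTip d ∉ V)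
    (h : c + dir K ∈ SixVertex.faceCorners (gapFace d)) : d = (c, K) ∨ d = (c - dir (K + 1), K) := by
  obtain ⟨v, k⟩ := d
  simp only at hd1
  simp only [dartTip] at hd2
  -- `v` and the ghost are corners of one face: frame coordinates of `v`
  have hclose := se_corners_close (se_self_mem_faceCorners_gapFace (v, k)) h
  obtain ⟨a, b, hvab, ha, hb⟩ := tp_coord_exists K (c + dir K) v
  have ha' : |a| ≤ 1 := ha.trans hclose
  have hb' : |b| ≤ 1 := hb.trans hclose
  rw [abs_le] at ha' hb'
  have hv : v = c + a • dir (K + 1) + (b + 1) • dir K := by rw [hvab]; module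
  have hb0 : b + 1 ≤ 0 := (hc a (b + 1) (by omega) (by omega) (by omega) (by omega)).1 (hv ▸ hd1)
  have hb1 : b = -1 := by omega
  subst hb1
  have hv0 : v = c + a • dir (K + 1) := by rw [hv]; simp
  -- the out-direction of the dart is `K`
  have hk : k = K := by
    rcases se_fin4_cases K k with rfl | rfl | rfl | rfl
    · rfl
    · exfalso; apply hd2
      have e : v + dir (K + 1) = c + (a + 1) • dir (K + 1) + (0 : ℤ) • dir K := by rw [hv0]; module
      rw [e]; exact (hc _ _ (by omega) (by omega) (by norm_num) (by norm_num)).2 le_rfl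
    · exfalso; apply hd2
      have e : v + dir (K + 2) = c + a • dir (K + 1) + (-1 : ℤ) • dir K := by rw [hv0, tp_dir_add_two]; module
      rw [e]; exact (hc _ _ (by omega) (by omega) (by norm_num) (by norm_num)).2 (by norm_num)
    · exfalso; apply hd2
      have e : v + dir (K + 3) = c + (a - 1) • dir (K + 1) + (0 : ℤ) • dir K := by rw [hv0, tp_dir_add_three]; module
      rw [e]; exact (hc _ _ (by omega) (by omega) (by norm_num) (by norm_num)).2 le_rfl
  subst hk
  rw [se_faceCorners_gapFace] at h
  simp only [Finset.mem_insert, Finset.mem_singleton] at h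
  have g0 : c + dir k = c + (0 : ℤ) • dir (k + 1) + (1 : ℤ) • dir k := by module
  rcases h with h | h | h | h
  · exfalso
    rw [hv0] at h
    have e : c + a • dir (k + 1) = c + a • dir (k + 1) + (0 : ℤ) • dir k := by module
    rw [e, g0, se_frame_inj] at h; omega
  · exfalso
    rw [hv0] at h
    have e : c + a • dir (k + 1) + dir (k + 1) = c + (a + 1) • dir (k + 1) + (0 : ℤ) • dir k := by module
    rw [e, g0, se_frame_inj] at h; omega
  · rw [hv0] at h
    have e : c + a • dir (k + 1) + dir k = c + a • dir (k + 1) + (1 : ℤ) • dir k := by module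
    rw [e, g0, se_frame_inj] at h
    left; rw [hv0, ← h.1]; simp
  · rw [hv0] at h
    have e : c + a • dir (k + 1) + dir k + dir (k + 1) = c + (a + 1) • dir (k + 1) + (1 : ℤ) • dir k := by module
    rw [e, g0, se_frame_inj] at h
    right
    have : a = -1 := by omega
    rw [hv0, this]; simp [sub_eq_add_neg]

end Rail2



/-! ### One dart of the walk, refined -/

/-- A silent dart with legs pending realises one or two of them: the level moves by `sgn` or
`2 sgn`, the sign is kept and fewer legs remain. [folklore] -/
theorem se_step_none_of_pending (s : WalkState) (hp : s.pending ≠ 0) :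
    ((s.step none).level = s.level + s.sgn ∨ (s.step none).level = s.level + 2 * s.sgn) ∧
      (s.step none).sgn = s.sgn ∧ (s.step none).pending < s.pending ∧
      (s.step none).level + (s.step none).sgn * (s.step none).pending = s.level + s.sgn * s.pending := by
  refine ⟨?_, ?_, ?_, potential_step_none s⟩
  · simp only [WalkState.step]
    split_ifs with h1 h2 h3
    · exact absurd h1 hp
    · left; rfl
    · right; rfl
    · left; rfl
  · simp only [WalkState.step]
    split_ifs <;> rfl
  · simp only [WalkState.step]
    split_ifs with h1 h2 h3
    · exact absurd h1 hp
    · dsimp only; omega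
    · dsimp only; omega
    · dsimp only; omega

/-- An insertion of `L ≥ 1` legs with sign `σ`: the level moves by `σ` or `2σ` and the sign
becomes `σ`. [folklore] -/
theorem se_step_some (s : WalkState) (L : ℕ) (σ : ℤ) (hL : 1 ≤ L) :
    ((s.step (some (L, σ))).level = s.level + σ ∨ (s.step (some (L, σ))).level = s.level + 2 * σ) ∧
      (s.step (some (L, σ))).sgn = σ := by
  simp only [WalkState.step]
  split_ifs with h1 h2 h3
  · exfalso
    have : L = 0 := by simpa using h1
    omega
  · exact ⟨Or.inl rfl, rfl⟩
  · exact ⟨Or.inr rfl, rfl⟩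
  · exact ⟨Or.inl rfl, rfl⟩

/-! ### Registered one-line form -/

/-- **Sub-goal `s14_strandEnds_rail`** (registered on stmt-CriticalPhenomena-14132): at a rail
point `c` of a flat boundary stretch with out-direction `K` (radius-`2` frame chart), an exterior
dart at `c` is `(c, K)`, the ghost `c + dir K` is the tip of `(c, K)` only, the gap face after
`(c, K)` belongs to `(c, K)` only, and a dart whose gap face has the ghost as a corner is `(c, K)`
or `(c - dir (K+1), K)`. [folklore] -/
theorem s14_strandEnds_rail : ∀ (V : Finset (ℤ × ℤ)) (K : Fin 4) (c : ℤ × ℤ), (∀ s t : ℤ, -2 ≤ s → s ≤ 2 → -2 ≤ t → t ≤ 2 → (c + s • Literature.Probability.LatticeModels.CollarLegModel.dir (K + 1) + t • Literature.Probability.LatticeModels.CollarLegModel.dir K ∈ V ↔ t ≤ 0)) → ∀ d : Literature.Probability.LatticeModels.CollarLegModel.Dart, d.1 ∈ V → Literature.Probability.LatticeModels.CollarLegModel.dartTip d ∉ V → (d.1 = c → d = (c, K)) ∧ (Literature.Probability.LatticeModels.CollarLegModel.dartTip d = c + Literature.Probability.LatticeModels.CollarLegModel.dir K → d = (c, K))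 ∧ (Literature.Probability.LatticeModels.CollarLegModel.gapFace d = Literature.Probability.LatticeModels.CollarLegModel.gapFace (c, K) → d = (c, K)) ∧ (c + Literature.Probability.LatticeModels.CollarLegModel.dir K ∈ Literature.Probability.LatticeModels.SixVertex.faceCorners (Literature.Probability.LatticeModels.CollarLegModel.gapFace d) → d = (c, K) ∨ d = (c - Literature.Probability.LatticeModels.CollarLegModel.dir (K + 1), K)) :=
  fun _ _ _ hc _ hd1 hd2 => ⟨fun h1 => se_rail_dart_unique hc h1 hd2, fun h2 => se_rail_tip_unique hc hd1 h2,
    fun h3 => se_rail_gapFace_unique hc hd1 hd2 h3, fun h4 => se_rail_ghostCorner hc hd1 hd2 h4⟩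

end Summit.CriticalPhenomena.CardyFormulaZ2.Cruxes.BoundaryDefectGaussianR.RainbowMonomialsInExcursionKernels
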